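import Mathlib
import HarnessLib
import Summits.HubbardSuperconductivity.HubbardSuperconductivity.Theorems.KLProgrammeKLRegimeEnginePairLadderSigned

/-!
# Route `KLProgramme` — crux K3, ENGINE child `KLRegimeEngineV11` (stmt-HubbardSuperconductivity-19823) and its gen-4 successor:
# the two ENGINE INPUTS of the signed (E2) bridge at the Matsubara-sum level — REALITY of the aggregated slice pair weights
# (`ν ↦ −ν` pairing) and the MASS INPUT from termwise positivity (deep zone) / total variation (edge zone)

Cell gate-hubbard-kl, seat hubbard-kl-k3c1-p1 (g3; technique «composed-map remainder propagation»); sequel to `…EnginePairLadderSigned`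
(`klpls_signedStepReal_of_expansion`, whose per-pair-class inputs are `hreal : ∀ p, Im Σ_b z′_(p,b) = 0` and
`hmass : (Σ_p ‖Σ_b z′_(p,b)‖) − Re Σ_p Σ_b z′_(p,b) ≤ E Qm`).

The engine's frequency-resolved slice pair weights at total momentum `Qm` have the shape `z′_(p,b) = T_p(ω_b)`, `b : MatsubaraIdx M`,
`T_p(ν) = N_p(ν) / D(ν; e₁, e₂)` with a REAL numerator even in `ν` (`N_p(ν) = c·s_n(ν² + e₁²)·s_n(ν² + e₂²)`, `c > 0`, `s_n ≥ 0` the slice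
profile, `e₁ = e_K(p)`, `e₂ = e_K(Qm − p)`) and the pair denominator `D(ν; e₁, e₂) = (−iν + e₁)(iν + e₂)` (= `(iν − e₁)(−iν − e₂)`, the other
sign convention: `klpws_pairDenom_conventions`), which is conjugation-symmetric under `ν ↦ −ν`.  Hence:
§1 `klpws_matsubara_sum_conj` / `klpws_matsubara_sum_im_eq_zero` — a `ν ↦ −ν` conjugation-symmetric summand has a REAL sum over the symmetric
finite frequency set `MatsubaraIdx M` (`matsubaraFreq_rev`); `klpws_matsubara_sum_re_nonneg` — termwise `0 ≤ Re` gives `0 ≤ Re Σ`;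
§2 `klpws_pairTerm_symm` — the pair term `N(ν)/D(ν)` is conjugation-symmetric; `klpws_pairDenom_re` — `Re D(ν; e₁, e₂) = ν² + e₁e₂` (the sign
that the deep-zone geometry controls: p1 g7's termwise lemma (α), STATUS l.1269, supplies `0 ≤ Re (N/D)` from `0 ≤ ν² + e₁e₂`);
§3 the mass input of the bridge: `klpws_massInput_deep` (every aggregated weight a nonnegative real ⇒ signed mass `0 ≤ E`) and
`klpws_massInput_edge` (always: signed mass `≤ 2·Σ‖z′‖ ≤ 2b ≤ E`) — with the gen-4 profile `E = 2·klEdge G n |Qm|_𝕋` the first serves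
`klEdgeKappa·|Qm|_𝕋 < Λ_n` (`0 ≤ klEdge`), the second the edge zone (`klEdge = G.bhi` there); `klpws_realInput` — reality per momentum `p`.
Pure bookkeeping over `Finset` sums and `Complex.conj`; nothing about the model is asserted.  0 kit.
-/

noncomputable section

namespace Summit.HubbardSuperconductivity.HubbardSuperconductivity.Theorems.KLRegimeSplit

set_option linter.dupNamespace false -- summit = problem name (single-conjunct summit), D-0017

open Finset Literature.MathematicalPhysics.QuantumLattice Literature.Probability.LatticeModels
open scoped ComplexConjugate

/-! ## §1 Conjugation-symmetric summands over the symmetric Matsubara set -/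

section Symmetric

variable {M : ℕ}

/-- Re-indexing by frequency reflection: `Σ_i g(rev i) = Σ_i g(i)`. -/
theorem klpws_sum_rev {A : Type*} [AddCommMonoid A] (g : MatsubaraIdx M → A) :
    ∑ i : MatsubaraIdx M, g i.rev = ∑ i : MatsubaraIdx M, g i :=
  Fintype.sum_equiv Fin.revPerm _ _ fun _ => rfl

/-- **A `ν ↦ −ν` conjugation-symmetric summand has a self-conjugate Matsubara sum**: `F(−ν) = conj F(ν)` for all `ν` ⇒
`conj (Σ_i F(ω_i)) = Σ_i F(ω_i)` over `i : MatsubaraIdx M` (the kept frequency set is reflection-symmetric, `matsubaraFreq_rev`). -/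
theorem klpws_matsubara_sum_conj (β : ℝ) (F : ℝ → ℂ) (hF : ∀ ν, F (-ν) = conj (F ν)) :
    conj (∑ i : MatsubaraIdx M, F (matsubaraFreq β M i)) = ∑ i : MatsubaraIdx M, F (matsubaraFreq β M i) := by
  rw [map_sum]
  calc ∑ i : MatsubaraIdx M, conj (F (matsubaraFreq β M i))
      = ∑ i : MatsubaraIdx M, F (matsubaraFreq β M i.rev) := by
        refine sum_congr rfl fun i _ => ?_
        rw [matsubaraFreq_rev, hF]
    _ = ∑ i : MatsubaraIdx M, F (matsubaraFreq β M i) := klpws_sum_rev fun i => F (matsubaraFreq β M i)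

/-- … hence the sum is REAL: `Im Σ_i F(ω_i) = 0`. -/
theorem klpws_matsubara_sum_im_eq_zero (β : ℝ) (F : ℝ → ℂ) (hF : ∀ ν, F (-ν) = conj (F ν)) :
    (∑ i : MatsubaraIdx M, F (matsubaraFreq β M i)).im = 0 := by
  have h := congrArg Complex.im (klpws_matsubara_sum_conj (M := M) β F hF)
  rw [Complex.conj_im] at h
  linarith

/-- Termwise `0 ≤ Re` gives `0 ≤ Re Σ_i F(ω_i)`. -/
theorem klpws_matsubara_sum_re_nonneg (β : ℝ) (F : ℝ → ℂ) (hre : ∀ i : MatsubaraIdx M, 0 ≤ (F (matsubaraFreq β M i)).re) :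
    0 ≤ (∑ i : MatsubaraIdx M, F (matsubaraFreq β M i)).re := by
  rw [Complex.re_sum]
  exact sum_nonneg fun i _ => hre i

end Symmetric

/-! ## §2 The pair term: conjugation symmetry and the real part of the pair denominator -/

section PairTerm

open Complex

/-- **The pair denominator** of a particle–particle pair at frequencies `(ν, −ν)` and energies `(e₁, e₂)`: `D(ν; e₁, e₂) = (−iν + e₁)(iν + e₂)`. -/
theorem klpws_pairDenom_conventions (ν e₁ e₂ : ℝ) :
    (I * ν - e₁) * (-(I * ν) - e₂) = (-(I * ν) + e₁) * (I * ν + e₂) := by ring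

/-- `Re D(ν; e₁, e₂) = ν² + e₁e₂` — the quantity whose sign the deep-zone geometry controls. -/
theorem klpws_pairDenom_re (ν e₁ e₂ : ℝ) : ((-(I * ν) + e₁) * (I * ν + e₂)).re = ν ^ 2 + e₁ * e₂ := by
  simp [Complex.mul_re, sq]; ring

/-- `Im D(ν; e₁, e₂) = ν(e₁ − e₂)`. -/
theorem klpws_pairDenom_im (ν e₁ e₂ : ℝ) : ((-(I * ν) + e₁) * (I * ν + e₂)).im = ν * (e₁ - e₂) := by
  simp [Complex.mul_im]; ring

/-- `‖D(ν; e₁, e₂)‖² = (ν² + e₁²)(ν² + e₂²)`. -/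
theorem klpws_pairDenom_normSq (ν e₁ e₂ : ℝ) : Complex.normSq ((-(I * ν) + e₁) * (I * ν + e₂)) = (ν ^ 2 + e₁ ^ 2) * (ν ^ 2 + e₂ ^ 2) := by
  rw [map_mul]
  have h1 : Complex.normSq (-(I * ν) + e₁) = ν ^ 2 + e₁ ^ 2 := by
    rw [Complex.normSq_apply]; simp; ring
  have h2 : Complex.normSq (I * ν + e₂) = ν ^ 2 + e₂ ^ 2 := by
    rw [Complex.normSq_apply]; simp; ring
  rw [h1, h2]

/-- Frequency reflection conjugates the pair denominator: `D(−ν) = conj D(ν)`. -/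
theorem klpws_pairDenom_neg (ν e₁ e₂ : ℝ) :
    (-(I * ((-ν : ℝ) : ℂ)) + e₁) * (I * ((-ν : ℝ) : ℂ) + e₂) = conj ((-(I * ν) + e₁) * (I * ν + e₂)) := by
  simp only [map_mul, map_add, map_neg, Complex.conj_I, Complex.conj_ofReal, Complex.ofReal_neg]
  ring

/-- **The pair term is conjugation-symmetric.**  For a real numerator `N` even in `ν` (the product of the two slice profiles at `ν² + e_i²`
times a positive constant), `T(ν) := N(ν)/D(ν; e₁, e₂)` satisfies `T(−ν) = conj T(ν)`; so `Σ_i T(ω_i)` is real (`klpws_matsubara_sum_im_eq_zero`). -/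
theorem klpws_pairTerm_symm (N : ℝ → ℝ) (hN : ∀ ν, N (-ν) = N ν) (e₁ e₂ ν : ℝ) :
    (N (-ν) : ℂ) / ((-(I * ((-ν : ℝ) : ℂ)) + e₁) * (I * ((-ν : ℝ) : ℂ) + e₂)) =
      conj ((N ν : ℂ) / ((-(I * ν) + e₁) * (I * ν + e₂))) := by
  rw [map_div₀, Complex.conj_ofReal, hN, klpws_pairDenom_neg]

/-- **Real part of the pair term**: `Re (N/D) = N·(ν² + e₁e₂)/((ν² + e₁²)(ν² + e₂²))` for a real numerator `N`. -/
theorem klpws_pairTerm_re (N e₁ e₂ ν : ℝ) :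
    ((N : ℂ) / ((-(I * ν) + e₁) * (I * ν + e₂))).re = N * (ν ^ 2 + e₁ * e₂) / ((ν ^ 2 + e₁ ^ 2) * (ν ^ 2 + e₂ ^ 2)) := by
  rw [Complex.div_re, Complex.ofReal_re, Complex.ofReal_im, klpws_pairDenom_re, klpws_pairDenom_normSq, zero_mul, zero_div, add_zero,
    mul_div_assoc]

/-- **Termwise positivity from the core sign**: `0 ≤ N` and (`N ≠ 0 → 0 ≤ ν² + e₁e₂`) ⇒ `0 ≤ Re (N/D)` (the geometric core `0 ≤ ν² + e₁e₂` deep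
inside the pair class is p1 g7's lemma (α); this is only the division bookkeeping). -/
theorem klpws_pairTerm_re_nonneg {N e₁ e₂ ν : ℝ} (hN : 0 ≤ N) (hcore : N ≠ 0 → 0 ≤ ν ^ 2 + e₁ * e₂) :
    0 ≤ ((N : ℂ) / ((-(I * ν) + e₁) * (I * ν + e₂))).re := by
  rw [klpws_pairTerm_re]
  by_cases h0 : N = 0
  · simp [h0]
  · exact div_nonneg (mul_nonneg hN (hcore h0)) (by positivity)

end PairTerm

/-! ## §3 The two inputs of the signed bridge: reality per momentum, and the mass input in the two zones -/

section Inputs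

variable {S : Type*} [Fintype S] {M : ℕ}

omit [Fintype S] in
/-- **Reality input** (`hreal` of `klpls_signedStepReal_of_expansion`): if for every momentum `s` the frequency-resolved weights are the values
`z′_(s,b) = T_s(ω_b)` of a `ν ↦ −ν` conjugation-symmetric function, then every aggregated weight is real. -/
theorem klpws_realInput (β : ℝ) (z' : S × MatsubaraIdx M → ℂ) (T : S → ℝ → ℂ) (hT : ∀ s ν, T s (-ν) = conj (T s ν))
    (hz : ∀ s b, z' (s, b) = T s (matsubaraFreq β M b)) : ∀ s, (∑ b, z' (s, b)).im = 0 := by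
  intro s
  simp only [hz]
  exact klpws_matsubara_sum_im_eq_zero β (T s) (hT s)

variable {F : Type*} [Fintype F]

/-- **Mass input, deep zone**: if every aggregated weight `Σ_b z′_(s,b)` is a nonnegative real then the signed mass vanishes, so it is `≤ E` for any
`0 ≤ E` (gen 4: `E = 2·klEdge G n |Qm|_𝕋 ≥ 0`). -/
theorem klpws_massInput_deep (z' : S × F → ℂ) {E : ℝ} (hE : 0 ≤ E)
    (hpos : ∀ s, 0 ≤ (∑ b, z' (s, b)).re ∧ (∑ b, z' (s, b)).im = 0) :
    (∑ s, ‖∑ b, z' (s, b)‖) - (∑ s, ∑ b, z' (s, b)).re ≤ E := by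
  rw [klpls_signedMass_eq_zero_of_pointwise (fun s => ∑ b, z' (s, b)) hpos]
  exact hE

/-- **Mass input, edge zone** (no sign information): the signed mass of the aggregated weights is `≤ 2·Σ‖z′‖ ≤ 2b ≤ E`
(gen 4: in the edge zone `Λ_n ≤ klEdgeKappa·|Qm|_𝕋` one has `klEdge G n |Qm|_𝕋 = G.bhi`, so `E = 2·G.bhi`). -/
theorem klpws_massInput_edge (z' : S × F → ℂ) {b E : ℝ} (hzb : ∑ x, ‖z' x‖ ≤ b) (hE : 2 * b ≤ E) :
    (∑ s, ‖∑ b, z' (s, b)‖) - (∑ s, ∑ b, z' (s, b)).re ≤ E := by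
  have h1 := klpls_signedMass_le_two_mul fun s => ∑ b, z' (s, b)
  have h2 := klell_sum_norm_aggregate_le z'
  linarith

/-- **Mass input, deep zone, from TERMWISE positivity** over the Matsubara index: if `z′_(s,b) = T_s(ω_b)` with `T_s` conjugation-symmetric and
`0 ≤ Re T_s(ω_b)` for all kept frequencies, then every aggregated weight is a nonnegative real and the signed mass is `≤ E` for any `0 ≤ E`. -/
theorem klpws_massInput_deep_of_termwise (β : ℝ) (z' : S × MatsubaraIdx M → ℂ) (T : S → ℝ → ℂ) {E : ℝ} (hE : 0 ≤ E)
    (hT : ∀ s ν, T s (-ν) = conj (T s ν)) (hz : ∀ s b, z' (s, b) = T s (matsubaraFreq β M b))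
    (hre : ∀ s (b : MatsubaraIdx M), 0 ≤ (T s (matsubaraFreq β M b)).re) :
    (∑ s, ‖∑ b, z' (s, b)‖) - (∑ s, ∑ b, z' (s, b)).re ≤ E := by
  refine klpws_massInput_deep z' hE fun s => ⟨?_, klpws_realInput β z' T hT hz s⟩
  simp only [hz]
  exact klpws_matsubara_sum_re_nonneg β (T s) (hre s)

end Inputs

end Summit.HubbardSuperconductivity.HubbardSuperconductivity.Theorems.KLRegimeSplit

end
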